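import Mathlib.Analysis.InnerProductSpace.Basic
import HarnessLib

/-!
# Route `UnitScaleTilt`, crux «MinimiserStabilityRegPr» (stmt-QuantumFields-19200, stub EX), positivity block, the LOD ∕ Combes–Thomas line (★p1 g24 LOCATE-P349-CT, ★★OWNER RULING №33),
# brick (L0′) — **THE ABSTRACT AGMON ESTIMATE FOR A CONSTRAINED CORRECTOR: exponential weights with BOUNDED CONJUGATION DEFECTS + a Poincaré inequality on the constraint space
# ⟹ the weighted energy bound `‖D(Mu)‖ ≤ 4·C_P·C_f`, `‖Mu‖ ≤ 8·C_P²·C_f`** (EX namer ∕ positivity-book holder w2 g11, 2026-08-29; LOCATE-L0prime-AGMON-w2g11 §(ii)(B))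

Cell `ym3-torus` (HUMAN RULING D-0037: YM₃ on T³ is ladder rung R3 — NOT d = 4, NOT infinite volume, NOT a mass gap, NOT Clay).  Width seat `ym-ust-19200-w2` (gen 11).
THEOREMS ONLY (0 `def`, 0 `sorry`); Mathlib only (no finite-dimensionality needed); carrier-free; `--supports stmt-QuantumFields-19200 --as helper`, count-neutral.

WHY (bus 21:44:24Z ∕ LOCATE-(L0′) 7e83dce2).  The Schur-budget Combes–Thomas engine of ✓p746438 (`inv_S_decay`, lit ✓`almostLocal_inverse_decay`) needs off-block couplings SMALL against
the accretivity; for `S = PΔ²P` at a T³ member the ratio is `~ ℓ⁴ = L^{4(K−n)}` in every basis, so the decay rate it yields vanishes with the member.  The member-uniform statement is the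
AGMON (commutator) form: conjugate by the weight `M = e^{μφ}` with `φ` the BLOCK-SCALED lattice distance (slope `η = L^{−(K−n)}` per fine bond), so that the conjugation defect of the
`η⁻¹`-normalised covariant difference `D` is `‖M′⁻¹DM − D‖ ≤ μe^{μη}√d` — BOUNDED, member-free — and absorb it with the Poincaré inequality on the constraint space (✓p746531 (L1):
`C_P² = 2` on `ker Q″`).  This file is that absorption, abstractly: two inner-product spaces `E` (sites), `F` (bonds), a linear `D : E → F`, an idempotent `Pt : E → E` (an oblique,
block-local projection onto the constraint space `W = {Pt w = w}`), weights `M, Mi` on `E` and `M′, M′i` on `F` (mutually inverse, `⟪M′a, M′i b⟫ = ⟪a, b⟫` — real positive weights),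
the four CONJUGATION DEFECTS `K₁, K₁′ : E → F`, `K₂, K₂′ : E → E` (`D∘M = M′∘(D + K₁)`, `D∘Mi = M′i∘(D + K₁′)`, `Pt∘M = M∘(Pt + K₂)`, `Pt∘Mi = Mi∘(Pt + K₂′)`) with bounds `δ₁, δ₂` and
`‖D∘K₂‖, ‖D∘K₂′‖ ≤ δ₃`, and a corrector `u ∈ W` of the energy-form Galerkin problem `⟪Dz, Du⟫ = ⟪z, f⟫ (z ∈ W)` whose source is `C_f`-local against the weight
(`|⟪Pt(M v), f⟫| ≤ C_f‖v‖`).  CONCLUSION: `‖D(Mu)‖ ≤ 4C_P·C_f` and `‖Mu‖ ≤ 8C_P²·C_f` once `δ₂ + C_Pδ₃ ≤ ½` and `2C_P·(δ₁ + ρ) + 4C_P²·ρδ₁ ≤ ½`, `ρ := 2δ₃ + δ₁(1 + 2δ₂)`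
— i.e. the corrector decays like `e^{−μφ}` away from its source, with `μ` limited only by `C_P` and the defect constants.  At the member (LOCATE §(ii)): `u = ψ_k` (LOD corrector of a
block bump `b_k`), `f = −Δb_k`, `Pt = 1 − Σ_k b_k⟨e_k, ·⟩`, and the localised basis `v_k = b_k + ψ_k` of `Δ(ker Q″)^⊥ = range(1 − R_{Q″})` feeds the COARSE Gram matrix, whose inverse
decays by ✓p746438's Schur CT (legitimate there: coercivity 1, O(1) decaying entries) — (V2) of LOCATE-P349-CT, member-uniformly.

INTERFACE = THE CHAIR's RESTORATION MAP (★p1 g24 21:49:33Z flag + cure, ★★OWNER RULING №34).  The constraint is restored by the OBLIQUE, block-local `Pt` (smooth bumps: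
`Pt = 1 − Σ_y β_y⟨e_y, ·⟩`, `Q″β_y = e_y`), NEVER by the orthogonal `P` whose indicator profiles jump across faces; and the equation is the SECOND-order energy form, so only `D` (not `Δ`)
meets the conjugation defects — the hypotheses are `‖K₂v‖ ≤ δ₂‖v‖` AND `‖D(K₂v)‖ ≤ δ₃‖v‖` (the `D`-graph size of `[Pt, W]`, `O(μ)` for smooth bumps), which is the located cure in
abstract form.  BOTH BASES OF THE LINE ARE INSTANCES: basis (ii) (correctors on `ker Q″`) as displayed; basis (i) (the UNCONSTRAINED massive propagator `G_a = (Δ_U + aQ″†Q″)⁻¹`,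
(L3′)) with `Pt := id` (`K₂ = K₂′ = 0`), `F := F ⊕ (coarse space)`, `D := D ⊕ √a·Q″` (so `⟪Dz, Du⟫` is the massive form), the Poincaré row := the GAP (L2′)
`‖λ‖² ≤ C_P²(‖D_Uλ‖² + a‖Q″λ‖²)`, and `K₁ ⊇ [√a·Q″, e^{μφ}] = O(μ)` (block-local mean).

WHAT IS PROVED (ns `…Theorems.Prop7CorrectorAgmonDecay`).
* §1 `weight_mem_sub` (`Pt(Mu) = Mu − K₂′(Mu)`), ★ `norm_weight_le_of_poincare` (`‖Mu‖ ≤ 2C_P‖D(Mu)‖` when `δ₂ + C_Pδ₃ ≤ ½`).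
* §2 `inner_test_eq` — the conjugated Galerkin identity `⟪Dz, Du⟫ = ⟪D(ũ + e) + K₁(ũ + e), Dũ + K₁′ũ⟫`, `ũ = Mu`, `z = Pt(Mũ)`, `e = K₂ũ − K₂′ũ`; `re_inner_le`, `energy_le` (bookkeeping).
* §3 ★★★ `agmon_corrector_bound` — the conclusion above.
HONEST SCOPE.  Inner-product algebra; the member rows (bumps with prescribed top means, the four defects and their constants, `C_f`) are (L2′), not here; nothing of (3.49), Thm 3.3, `h349`,
`hGF`, EX or the crux is proved; nothing continuum ∕ OS ∕ mass-gap ∕ Clay.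

References: S. Agmon, *Lectures on exponential decay of solutions of second-order elliptic equations*, Princeton 1982 (the weighted-energy technique) [folklore]; A. Målqvist, D. Peterseim,
Math. Comp. **83** (2014) 2583–2603 (LOD corrector decay; no statement of theirs is typed) [folklore]; T. Bałaban, CMP **99** (1985) 389–434 [Balaban1985BackgroundPropagators]
((3.49) p.399 — the row this line serves; Thm 3.11 p.416).
-/

set_option autoImplicit false

noncomputable section

open scoped InnerProductSpace ComplexConjugate

namespace Summit.QuantumFields.YangMills.Theorems.Prop7CorrectorAgmonDecay

variable {E F : Type*} [NormedAddCommGroup E] [InnerProductSpace ℂ E] [NormedAddCommGroup F] [InnerProductSpace ℂ F]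

/-! ## §1 The weighted Poincaré inequality -/

/-- `Pt(Mu) = Mu − K₂′(Mu)` for `u ∈ W`: from `Pt∘Mi = Mi∘(Pt + K₂′)` at `Mu`, `Mi(Mu) = u = Pt u`, then apply `M`. [folklore] -/
theorem weight_mem_sub (Pt M Mi K₂' : E →ₗ[ℂ] E) (hMiM : ∀ v, Mi (M v) = v) (hMMi : ∀ v, M (Mi v) = v)
    (hK₂' : ∀ v, Pt (Mi v) = Mi (Pt v + K₂' v)) (u : E) (hu : Pt u = u) :
    Pt (M u) = M u - K₂' (M u) := by
  have h1 : u = Mi (Pt (M u) + K₂' (M u)) := by rw [← hK₂', hMiM, hu]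
  have h2 : M u = Pt (M u) + K₂' (M u) := by
    conv_lhs => rw [h1]
    rw [hMMi]
  rw [eq_sub_iff_add_eq, ← h2]

/-- ★ **WEIGHTED POINCARÉ.**  `Pt` idempotent, `‖w‖ ≤ C_P‖Dw‖` on `{Pt w = w}`, `u = Pt u`, mutually inverse weights, `Pt∘Mi = Mi∘(Pt + K₂′)` with `‖K₂′v‖ ≤ δ₂‖v‖`, `‖D(K₂′v)‖ ≤ δ₃‖v‖`,
`δ₂ + C_Pδ₃ ≤ ½` ⟹ `‖Mu‖ ≤ 2C_P‖D(Mu)‖`. [folklore] -/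
theorem norm_weight_le_of_poincare (D : E →ₗ[ℂ] F) (Pt : E →ₗ[ℂ] E) (hPt : ∀ v, Pt (Pt v) = Pt v)
    {CP : ℝ} (hCP : 0 ≤ CP) (hPoinc : ∀ w, Pt w = w → ‖w‖ ≤ CP * ‖D w‖)
    (M Mi : E →ₗ[ℂ] E) (hMiM : ∀ v, Mi (M v) = v) (hMMi : ∀ v, M (Mi v) = v)
    (K₂' : E →ₗ[ℂ] E) (hK₂' : ∀ v, Pt (Mi v) = Mi (Pt v + K₂' v))
    {δ₂ δ₃ : ℝ} (bK₂' : ∀ v, ‖K₂' v‖ ≤ δ₂ * ‖v‖) (bDK₂' : ∀ v, ‖D (K₂' v)‖ ≤ δ₃ * ‖v‖)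
    (hsmall : δ₂ + CP * δ₃ ≤ 1 / 2) (u : E) (hu : Pt u = u) :
    ‖M u‖ ≤ 2 * CP * ‖D (M u)‖ := by
  have hid := weight_mem_sub Pt M Mi K₂' hMiM hMMi hK₂' u hu
  -- Poincaré at `w := Pt (M u)`
  have hP := hPoinc (Pt (M u)) (hPt (M u))
  have hDw : ‖D (Pt (M u))‖ ≤ ‖D (M u)‖ + δ₃ * ‖M u‖ := by
    rw [hid, map_sub]
    exact (norm_sub_le _ _).trans (add_le_add le_rfl (bDK₂' _))
  have hsplit : ‖M u‖ ≤ ‖Pt (M u)‖ + δ₂ * ‖M u‖ := by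
    have e : M u = Pt (M u) + K₂' (M u) := by rw [hid, sub_add_cancel]
    calc ‖M u‖ = ‖Pt (M u) + K₂' (M u)‖ := by rw [← e]
      _ ≤ ‖Pt (M u)‖ + ‖K₂' (M u)‖ := norm_add_le _ _
      _ ≤ ‖Pt (M u)‖ + δ₂ * ‖M u‖ := add_le_add le_rfl (bK₂' _)
  have h0 : 0 ≤ ‖M u‖ := norm_nonneg _
  have h1 : 0 ≤ ‖D (M u)‖ := norm_nonneg _
  nlinarith [mul_le_mul_of_nonneg_left hDw hCP]

/-! ## §2 The conjugated Galerkin identity and its bookkeeping -/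

/-- **THE CONJUGATED TEST.**  With `ũ := Mu`, `e := K₂ũ − K₂′ũ`, `z := Pt(Mũ)`: `z = M(ũ + e)`, `u = Mi ũ`, and
`⟪Dz, Du⟫ = ⟪D(ũ + e) + K₁(ũ + e), Dũ + K₁′ũ⟫` (the weights cancel through `⟪M′a, M′i b⟫ = ⟪a, b⟫`). [folklore] -/
theorem inner_test_eq (D : E →ₗ[ℂ] F) (Pt M Mi : E →ₗ[ℂ] E) (M' M'i : F →ₗ[ℂ] F)
    (hMiM : ∀ v, Mi (M v) = v) (hMMi : ∀ v, M (Mi v) = v) (hpair : ∀ a b, ⟪M' a, M'i b⟫_ℂ = ⟪a, b⟫_ℂ)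
    (K₁ K₁' : E →ₗ[ℂ] F) (K₂ K₂' : E →ₗ[ℂ] E)
    (hK₁ : ∀ v, D (M v) = M' (D v + K₁ v)) (hK₁' : ∀ v, D (Mi v) = M'i (D v + K₁' v))
    (hK₂ : ∀ v, Pt (M v) = M (Pt v + K₂ v)) (hK₂' : ∀ v, Pt (Mi v) = Mi (Pt v + K₂' v))
    (u : E) (hu : Pt u = u) :
    ⟪D (Pt (M (M u))), D u⟫_ℂ
      = ⟪D (M u + (K₂ (M u) - K₂' (M u))) + K₁ (M u + (K₂ (M u) - K₂' (M u))), D (M u) + K₁' (M u)⟫_ℂ := by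
  have hid := weight_mem_sub Pt M Mi K₂' hMiM hMMi hK₂' u hu
  -- `z = M (ũ + e)`
  have hz : Pt (M (M u)) = M (M u + (K₂ (M u) - K₂' (M u))) := by
    rw [hK₂ (M u), hid]
    congr 1
    abel
  -- `D u = M'i (D ũ + K₁' ũ)`
  have hDu : D u = M'i (D (M u) + K₁' (M u)) := by
    conv_lhs => rw [← hMiM u]
    exact hK₁' (M u)
  rw [hz, hK₁, hDu, hpair]

/-- `re ⟪x, y⟫ ≤ ‖x‖‖y‖` and `−re ⟪x, y⟫ ≤ ‖x‖‖y‖`. [folklore] -/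
theorem re_inner_le (x y : F) : RCLike.re ⟪x, y⟫_ℂ ≤ ‖x‖ * ‖y‖ ∧ -RCLike.re ⟪x, y⟫_ℂ ≤ ‖x‖ * ‖y‖ := by
  have h := norm_inner_le_norm (𝕜 := ℂ) x y
  have h1 := RCLike.re_le_norm (⟪x, y⟫_ℂ)
  have h2 : -RCLike.re ⟪x, y⟫_ℂ ≤ ‖⟪x, y⟫_ℂ‖ := by
    have := RCLike.re_le_norm (-⟪x, y⟫_ℂ)
    rwa [map_neg, norm_neg] at this
  exact ⟨h1.trans h, h2.trans h⟩

/-- **ENERGY BOOKKEEPING.**  If `re⟪X + r, X + s⟫ ≤ c` then `‖X‖² ≤ c + ‖X‖‖s‖ + ‖r‖‖X‖ + ‖r‖‖s‖`. [folklore] -/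
theorem energy_le (X r s : F) {c : ℝ} (h : RCLike.re ⟪X + r, X + s⟫_ℂ ≤ c) :
    ‖X‖ ^ 2 ≤ c + ‖X‖ * ‖s‖ + ‖r‖ * ‖X‖ + ‖r‖ * ‖s‖ := by
  rw [inner_add_left, inner_add_right, inner_add_right, map_add, map_add, map_add, inner_self_eq_norm_sq] at h
  linarith [(re_inner_le X s).2, (re_inner_le r X).2, (re_inner_le r s).2]

/-! ## §3 ★★★ The Agmon bound -/

/-- ★★★ **THE ABSTRACT AGMON ESTIMATE FOR A CONSTRAINED CORRECTOR.**  Data: `D : E → F` linear; `Pt` idempotent with the Poincaré inequality `‖w‖ ≤ C_P‖Dw‖` on `{Pt w = w}`; weights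
`M, Mi` on `E` and `M′, M′i` on `F`, mutually inverse, `⟪M′a, M′i b⟫ = ⟪a, b⟫`; conjugation defects `D∘M = M′∘(D + K₁)`, `D∘Mi = M′i∘(D + K₁′)`, `Pt∘M = M∘(Pt + K₂)`,
`Pt∘Mi = Mi∘(Pt + K₂′)` with `‖K₁v‖, ‖K₁′v‖ ≤ δ₁‖v‖`, `‖K₂v‖, ‖K₂′v‖ ≤ δ₂‖v‖`, `‖D(K₂v)‖, ‖D(K₂′v)‖ ≤ δ₃‖v‖`; smallness `δ₂ + C_Pδ₃ ≤ ½` and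
`2C_P(δ₁ + ρ) + 4C_P²ρδ₁ ≤ ½`, `ρ = 2δ₃ + δ₁(1 + 2δ₂)`.  If `u = Pt u` solves `⟪Dz, Du⟫ = ⟪z, f⟫` for all `z = Pt z` and `|⟪Pt(Mv), f⟫| ≤ C_f‖v‖`, then
`‖D(Mu)‖ ≤ 4C_P·C_f` and `‖Mu‖ ≤ 8C_P²·C_f`. [folklore] -/
theorem agmon_corrector_bound (D : E →ₗ[ℂ] F) (Pt : E →ₗ[ℂ] E) (hPt : ∀ v, Pt (Pt v) = Pt v)
    {CP : ℝ} (hCP : 0 ≤ CP) (hPoinc : ∀ w, Pt w = w → ‖w‖ ≤ CP * ‖D w‖)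
    (M Mi : E →ₗ[ℂ] E) (M' M'i : F →ₗ[ℂ] F) (hMiM : ∀ v, Mi (M v) = v) (hMMi : ∀ v, M (Mi v) = v)
    (hpair : ∀ a b, ⟪M' a, M'i b⟫_ℂ = ⟪a, b⟫_ℂ)
    (K₁ K₁' : E →ₗ[ℂ] F) (K₂ K₂' : E →ₗ[ℂ] E)
    (hK₁ : ∀ v, D (M v) = M' (D v + K₁ v)) (hK₁' : ∀ v, D (Mi v) = M'i (D v + K₁' v))
    (hK₂ : ∀ v, Pt (M v) = M (Pt v + K₂ v)) (hK₂' : ∀ v, Pt (Mi v) = Mi (Pt v + K₂' v))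
    {δ₁ δ₂ δ₃ : ℝ} (hδ₁ : 0 ≤ δ₁) (hδ₂ : 0 ≤ δ₂) (hδ₃ : 0 ≤ δ₃)
    (bK₁ : ∀ v, ‖K₁ v‖ ≤ δ₁ * ‖v‖) (bK₁' : ∀ v, ‖K₁' v‖ ≤ δ₁ * ‖v‖)
    (bK₂ : ∀ v, ‖K₂ v‖ ≤ δ₂ * ‖v‖) (bK₂' : ∀ v, ‖K₂' v‖ ≤ δ₂ * ‖v‖)
    (bDK₂ : ∀ v, ‖D (K₂ v)‖ ≤ δ₃ * ‖v‖) (bDK₂' : ∀ v, ‖D (K₂' v)‖ ≤ δ₃ * ‖v‖)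
    (hsmall₁ : δ₂ + CP * δ₃ ≤ 1 / 2)
    (hsmall₂ : 2 * CP * (δ₁ + (2 * δ₃ + δ₁ * (1 + 2 * δ₂))) + 4 * CP ^ 2 * ((2 * δ₃ + δ₁ * (1 + 2 * δ₂)) * δ₁) ≤ 1 / 2)
    (u : E) (hu : Pt u = u) (f : E) (heq : ∀ z, Pt z = z → ⟪D z, D u⟫_ℂ = ⟪z, f⟫_ℂ)
    {Cf : ℝ} (hCf : 0 ≤ Cf) (hf : ∀ v, ‖⟪Pt (M v), f⟫_ℂ‖ ≤ Cf * ‖v‖) :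
    ‖D (M u)‖ ≤ 4 * CP * Cf ∧ ‖M u‖ ≤ 8 * CP ^ 2 * Cf := by
  -- letters
  set ut : E := M u with hut
  set e : E := K₂ ut - K₂' ut with he
  set r : F := D e + K₁ (ut + e) with hr
  set s : F := K₁' ut with hs
  -- the weighted Poincaré
  have hP : ‖ut‖ ≤ 2 * CP * ‖D ut‖ :=
    norm_weight_le_of_poincare D Pt hPt hCP hPoinc M Mi hMiM hMMi K₂' hK₂' bK₂' bDK₂' hsmall₁ u hu
  -- the conjugated identity, read as `re⟪Dũ + r, Dũ + s⟫ = re⟪z, f⟫ ≤ C_f‖ũ‖`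
  have hzW : Pt (Pt (M ut)) = Pt (M ut) := hPt _
  have hid := inner_test_eq D Pt M Mi M' M'i hMiM hMMi hpair K₁ K₁' K₂ K₂' hK₁ hK₁' hK₂ hK₂' u hu
  have hXY : ⟪D ut + r, D ut + s⟫_ℂ = ⟪Pt (M ut), f⟫_ℂ := by
    have e1 : D ut + r = D (M u + (K₂ (M u) - K₂' (M u))) + K₁ (M u + (K₂ (M u) - K₂' (M u))) := by
      rw [hr, he, hut]; simp only [map_add, map_sub]; abel
    rw [e1, hs, hut, ← hid, heq _ hzW]
  have hre : RCLike.re ⟪D ut + r, D ut + s⟫_ℂ ≤ Cf * ‖ut‖ := by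
    rw [hXY]
    exact (RCLike.re_le_norm _).trans (hf ut)
  have hE := energy_le (D ut) r s hre
  -- sizes of `e`, `r`, `s`
  have hs' : ‖s‖ ≤ δ₁ * ‖ut‖ := bK₁' ut
  have he' : ‖e‖ ≤ 2 * δ₂ * ‖ut‖ := by
    rw [he]
    calc ‖K₂ ut - K₂' ut‖ ≤ ‖K₂ ut‖ + ‖K₂' ut‖ := norm_sub_le _ _
      _ ≤ δ₂ * ‖ut‖ + δ₂ * ‖ut‖ := add_le_add (bK₂ ut) (bK₂' ut)
      _ = 2 * δ₂ * ‖ut‖ := by ring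
  have hDe : ‖D e‖ ≤ 2 * δ₃ * ‖ut‖ := by
    rw [he, map_sub]
    calc ‖D (K₂ ut) - D (K₂' ut)‖ ≤ ‖D (K₂ ut)‖ + ‖D (K₂' ut)‖ := norm_sub_le _ _
      _ ≤ δ₃ * ‖ut‖ + δ₃ * ‖ut‖ := add_le_add (bDK₂ ut) (bDK₂' ut)
      _ = 2 * δ₃ * ‖ut‖ := by ring
  have hK₁e : ‖K₁ (ut + e)‖ ≤ δ₁ * (1 + 2 * δ₂) * ‖ut‖ := by
    calc ‖K₁ (ut + e)‖ ≤ δ₁ * ‖ut + e‖ := bK₁ _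
      _ ≤ δ₁ * (‖ut‖ + ‖e‖) := mul_le_mul_of_nonneg_left (norm_add_le _ _) hδ₁
      _ ≤ δ₁ * (‖ut‖ + 2 * δ₂ * ‖ut‖) := mul_le_mul_of_nonneg_left (add_le_add le_rfl he') hδ₁
      _ = δ₁ * (1 + 2 * δ₂) * ‖ut‖ := by ring
  have hr' : ‖r‖ ≤ (2 * δ₃ + δ₁ * (1 + 2 * δ₂)) * ‖ut‖ := by
    rw [hr]
    calc ‖D e + K₁ (ut + e)‖ ≤ ‖D e‖ + ‖K₁ (ut + e)‖ := norm_add_le _ _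
      _ ≤ 2 * δ₃ * ‖ut‖ + δ₁ * (1 + 2 * δ₂) * ‖ut‖ := add_le_add hDe hK₁e
      _ = (2 * δ₃ + δ₁ * (1 + 2 * δ₂)) * ‖ut‖ := by ring
  -- absorb: `‖Dũ‖² ≤ C_f‖ũ‖ + (δ₁ + ρ)‖ũ‖‖Dũ‖ + ρδ₁‖ũ‖²`, `‖ũ‖ ≤ 2C_P‖Dũ‖`
  set X : ℝ := ‖D ut‖ with hX
  set N : ℝ := ‖ut‖ with hN
  set ρ : ℝ := 2 * δ₃ + δ₁ * (1 + 2 * δ₂) with hρ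
  have hX0 : 0 ≤ X := norm_nonneg _
  have hN0 : 0 ≤ N := norm_nonneg _
  have hρ0 : 0 ≤ ρ := by rw [hρ]; positivity
  have hr0 : 0 ≤ ‖r‖ := norm_nonneg _
  have hs0 : 0 ≤ ‖s‖ := norm_nonneg _
  have hE' : X ^ 2 ≤ Cf * N + X * (δ₁ * N) + (ρ * N) * X + (ρ * N) * (δ₁ * N) := by
    have h1 : X * ‖s‖ ≤ X * (δ₁ * N) := mul_le_mul_of_nonneg_left hs' hX0
    have h2 : ‖r‖ * X ≤ (ρ * N) * X := mul_le_mul_of_nonneg_right hr' hX0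
    have h3 : ‖r‖ * ‖s‖ ≤ (ρ * N) * (δ₁ * N) := mul_le_mul hr' hs' hs0 (by positivity)
    linarith [hE]
  -- substitute the Poincaré bound `N ≤ 2C_P·X`
  have hNX : N ≤ 2 * CP * X := hP
  have hCPX : 0 ≤ 2 * CP * X := by positivity
  have hE'' : X ^ 2 ≤ Cf * (2 * CP * X) + (2 * CP * (δ₁ + ρ) + 4 * CP ^ 2 * (ρ * δ₁)) * X ^ 2 := by
    have h1 : Cf * N ≤ Cf * (2 * CP * X) := mul_le_mul_of_nonneg_left hNX hCf
    have h2 : X * (δ₁ * N) ≤ X * (δ₁ * (2 * CP * X)) := mul_le_mul_of_nonneg_left (mul_le_mul_of_nonneg_left hNX hδ₁) hX0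
    have h3 : (ρ * N) * X ≤ (ρ * (2 * CP * X)) * X := mul_le_mul_of_nonneg_right (mul_le_mul_of_nonneg_left hNX hρ0) hX0
    have h4 : (ρ * N) * (δ₁ * N) ≤ (ρ * (2 * CP * X)) * (δ₁ * (2 * CP * X)) :=
      mul_le_mul (mul_le_mul_of_nonneg_left hNX hρ0) (mul_le_mul_of_nonneg_left hNX hδ₁) (by positivity) (by positivity)
    nlinarith [hE']
  have hcoef : 2 * CP * (δ₁ + ρ) + 4 * CP ^ 2 * (ρ * δ₁) ≤ 1 / 2 := by rw [hρ]; linarith [hsmall₂]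
  have hX2 : X ^ 2 ≤ 4 * CP * Cf * X := by nlinarith [mul_le_mul_of_nonneg_right hcoef (sq_nonneg X)]
  have hXb : X ≤ 4 * CP * Cf := by
    by_cases hX' : X = 0
    · rw [hX']; positivity
    · have hXp : 0 < X := lt_of_le_of_ne hX0 (Ne.symm hX')
      nlinarith
  refine ⟨hXb, ?_⟩
  calc N ≤ 2 * CP * X := hNX
    _ ≤ 2 * CP * (4 * CP * Cf) := mul_le_mul_of_nonneg_left hXb (by positivity)
    _ = 8 * CP ^ 2 * Cf := by ring

end Summit.QuantumFields.YangMills.Theorems.Prop7CorrectorAgmonDecay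

end
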